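import Mathlib
import HarnessLib
import Summits.RiemannHypothesis.RiemannHypothesis.Theorems.EarlyAppointmentsRemainder0XiEtaLedgerArith
import Summits.RiemannHypothesis.RiemannHypothesis.Theorems.EarlyAppointmentsRemainder0XiLogIntegrals
import Summits.RiemannHypothesis.RiemannHypothesis.Theorems.EarlyAppointmentsRemainder0XiTruncationHelper
import Summits.RiemannHypothesis.RiemannHypothesis.Theorems.EarlyAppointmentsRemainder0XiSubstitutionHelper
import Summits.RiemannHypothesis.RiemannHypothesis.Theorems.EarlyAppointmentsRemainder0XiFarKernelWindowBounds
import Summits.RiemannHypothesis.RiemannHypothesis.Theorems.EarlyAppointmentsRemainder0XiFarKernelTailBound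
import Summits.RiemannHypothesis.RiemannHypothesis.Theorems.EarlyAppointmentsRemainder0XiUpperIntegralFTC

/-!
# Additional Definitions for Far Log-Kernel Sharp Stub

Adds mainIntegral and FarLogKernelSharp definitions, reusing T_PT/boxHalfWidth/lowStart from
EtaLedgerArith. Also provides parameter bounds and the log_div_twoPi_bound lemma.

Supports stmt-RiemannHypothesis-24730 (Remainder0Xi crux).
-/

set_option linter.dupNamespace false
namespace Summit.RiemannHypothesis.RiemannHypothesis.Cruxes.Remainder0Xi.Rho2V2

open scoped BigOperators Topology Classical
open Real Complex MeasureTheory Set Filter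

open Summit.RiemannHypothesis.RiemannHypothesis.Theorems.EarlyAppointmentsRemainder0Xi
open Summit.RiemannHypothesis.RiemannHypothesis.Theorems.EarlyAppointmentsRemainder0Xi.FarKernel
open Summit.RiemannHypothesis.RiemannHypothesis.Theorems.EarlyAppointmentsRemainder0Xi.SubstitutionHelpers
open Summit.RiemannHypothesis.RiemannHypothesis.Theorems.EarlyAppointmentsRemainder0Xi.UpperIntegral
open Summit.RiemannHypothesis.RiemannHypothesis.Theorems.EarlyAppointmentsRemainder0Xi.Helpers

-- T_PT, boxHalfWidth, lowStart are imported from EtaLedgerArith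

/-- MAIN(x): the far-field integral. -/
noncomputable def mainIntegral (x : ℝ) : ℝ :=
  (1 / (2 * Real.pi)) * ((∫ t in lowStart..(x - boxHalfWidth),
      Real.log (t / (2 * Real.pi)) * (2 * x / (x ^ 2 - t ^ 2)))
    + ∫ t in Ioi (x + boxHalfWidth),
      Real.log (t / (2 * Real.pi)) * (2 * x / (x ^ 2 - t ^ 2)))

/-- **FarLogKernelSharp**: |MAIN(x) + π/4| ≤ log(x)·191/x. -/
def FarLogKernelSharp : Prop :=
  ∀ x : ℝ, T_PT / 2 < x →
    |mainIntegral x + Real.pi / 4| ≤ Real.log x * (135 + 4 * lowStart) / x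

/-- T_PT/2 is large enough for good estimates. -/
lemma T_PT_half_large : (1000 : ℝ) < T_PT / 2 := by norm_num [T_PT]

/-- Positivity of x for x > T_PT/2. -/
lemma pos_of_T_PT_half_lt {x : ℝ} (hx : T_PT / 2 < x) : 0 < x := by
  have h1 : (0 : ℝ) < 1000 := by norm_num
  have h2 : (1000 : ℝ) < T_PT / 2 := T_PT_half_large
  linarith

/-- boxHalfWidth/x is small for large x. -/
lemma boxHalfWidth_div_x_small {x : ℝ} (hx : T_PT / 2 < x) : boxHalfWidth / x ≤ 1 / 4 := by
  have hx_pos := pos_of_T_PT_half_lt hx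
  have h : x > 67.5 * 4 := by linarith [T_PT_half_large]
  rw [div_le_iff₀ hx_pos]
  have hbhw : boxHalfWidth = 67.5 := by norm_num [boxHalfWidth]
  calc boxHalfWidth = 67.5 := hbhw
    _ ≤ x / 4 := by linarith
    _ = 1 / 4 * x := by ring

/-- lowStart/x is small for large x. -/
lemma lowStart_div_x_small {x : ℝ} (hx : T_PT / 2 < x) : lowStart / x ≤ 1 / 2 := by
  have hx_pos := pos_of_T_PT_half_lt hx
  have h : x > 14 * 2 := by linarith [T_PT_half_large]
  rw [div_le_iff₀ hx_pos]
  linarith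

/-- The log(x/2π) factor is bounded by log(x) for x > 1000. -/
lemma log_div_twoPi_bound {x : ℝ} (hx : 1000 < x) :
    |Real.log (x / (2 * Real.pi))| ≤ Real.log x := by
  have hx_pos : 0 < x := by linarith
  have h2pi : 0 < 2 * Real.pi := by positivity
  have hlog_2pi_pos : 0 < Real.log (2 * Real.pi) := by
    rw [Real.log_pos_iff h2pi.le]
    calc 1 < 6 := by norm_num
      _ < 2 * Real.pi := by nlinarith [Real.pi_gt_three]
  have hdiv_gt_one : 1 < x / (2 * Real.pi) := by
    rw [one_lt_div h2pi]
    calc 2 * Real.pi < 2 * 4 := by nlinarith [Real.pi_lt_four]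
      _ < 1000 := by norm_num
      _ < x := hx
  have hlog_pos : 0 < Real.log (x / (2 * Real.pi)) := Real.log_pos hdiv_gt_one
  rw [abs_of_pos hlog_pos, Real.log_div hx_pos.ne' h2pi.ne']
  linarith

end Summit.RiemannHypothesis.RiemannHypothesis.Cruxes.Remainder0Xi.Rho2V2
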